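import Literature.Probability.Percolation.ZdFourArmFromFiveArm
import Summits.CriticalPhenomena.CardyFormulaZ2.Theorems.CardyMeckeFlipFlipErgodicityZ2StubLatticeSecondMomentEdgeArm

/-!
# Crux `FlipErgodicityZ2` (stmt-CriticalPhenomena-14825), line `registered`, stub
# `stub_latticeSecondMoment`: pair probabilities of edge four-arm events

Route `Summits/CriticalPhenomena/CardyFormulaZ2/Theses/CardyMeckeFlip`.  Helper file (supports the
crux item).  The second step of the classical second-moment computation for the number of
important / pivotal edges (Garban–Pete–Schramm, JAMS 26 (2013), §4.3–4.4; Kesten 1987): for two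
edges `e = s(x, x + eᵢ)`, `e' = s(y, y + e_j)` of `ℤ²` at sup-distance `ℓ = ‖y - x‖_∞` and the
events `A_e = edgeFourArm (x + [-M,M]²) x i`, `A_{e'}` of four alternating arms from the edge to
the boundary of the box of radius `M` around it,

* `real_inter_edgeFourArm_le_sq` — if `ℓ > 2h` (`1 ≤ h ≤ M`): `P(A_e ∩ A_{e'}) ≤ a(h)²`, where
  `a(h) = P(edgeFourArm [-h,h]² 0 0)`: both edges have four arms to distance `h`, two events read
  on the disjoint boxes `x + [-h,h]²`, `y + [-h,h]²`, hence independent;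
* `real_inter_edgeFourArm_le_sq_mul` — if moreover `ℓ + h ≤ L - 1` and `L ≤ M`:
  `P(A_e ∩ A_{e'}) ≤ a(h)² · α₄(L, M)` with `α₄(L,M) = P(fourArmTwoClusters L M)` the cluster-form
  four-arm probability of the annulus `A_{L,M}` (`FourArmGarban.lean`): the arms of `e` also
  cross the annulus `x + A_{L,M}` (`relabel_mem_fourArmTwoClusters_of_edgeFourArm`), a third
  event read on the pairs of `x + A_{L,M}`, disjoint from the two small boxes — three mutually
  independent events (product structure of `P_{1/2}`, `bondPercolation_real_inter_of_disjoint`);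
* `real_inter_edgeFourArm_le_self` — in any case `P(A_e ∩ A_{e'}) ≤ a(M)`.

Also: the sup-norm box arithmetic used to check the disjointness of the three regions.
-/

noncomputable section

open MeasureTheory Set
open Literature.Probability.Percolation Literature.Probability.LatticeModels

namespace Summit.CriticalPhenomena.CardyFormulaZ2.Theorems.CardyMeckeFlip

/-! ### Determination under relabelling; pairs of disjoint vertex sets -/

/-- Pairs of sites of disjoint vertex sets are disjoint. [folklore] -/
theorem disjoint_sym2_of_forall {S : Set (Sym2 (Site 2))} {W : Set (Site 2)}
    (h : ∀ e ∈ S, ∀ a ∈ e, a ∉ W) : Disjoint W.sym2 S := by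
  rw [Set.disjoint_left]
  intro e heW heS
  induction e using Sym2.ind with
  | h a b =>
    rw [Set.mk_mem_sym2_iff] at heW
    exact h _ heS a (Sym2.mem_mk_left a b) heW.1

/-- Membership in the pull-back of the pairs of a finite set under a relabelling of the sites.
[folklore] -/
theorem mem_preimage_sym2Equiv_sym2 (φ : Site 2 ≃ Site 2) (F : Finset (Site 2))
    (e : Sym2 (Site 2)) :
    e ∈ (sym2Equiv φ) ⁻¹' (↑(F.sym2) : Set (Sym2 (Site 2))) ↔ ∀ a ∈ e, φ a ∈ F := by
  rw [mem_preimage, Finset.mem_coe, Finset.mem_sym2_iff, sym2Equiv_apply]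
  constructor
  · intro h a ha
    exact h (φ a) (Sym2.mem_map.2 ⟨a, ha, rfl⟩)
  · intro h b hb
    obtain ⟨a, ha, rfl⟩ := Sym2.mem_map.1 hb
    exact h a ha

/-! ### Sup-norm box arithmetic -/

/-- `B(a) + B(b) ⊆ B(a + b)`. [folklore] -/
theorem add_mem_box {a b : ℕ} {p q : Site 2} (hp : p ∈ box 2 a) (hq : q ∈ box 2 b) :
    p + q ∈ box 2 (a + b) := by
  rw [mem_box] at hp hq ⊢
  intro k
  have h1 := hp k
  have h2 := hq k
  simp only [Pi.add_apply]
  push_cast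
  omega

/-- Two boxes of radius `h` whose centres are at sup-distance `> 2h` are disjoint. [folklore] -/
theorem shiftBox_disjoint {x y : Site 2} {h : ℕ} (hxy : y - x ∉ box 2 (2 * h)) :
    Disjoint {u : Site 2 | u - x ∈ box 2 h} {u : Site 2 | u - y ∈ box 2 h} := by
  rw [Set.disjoint_left]
  intro u hux huy
  apply hxy
  have key : u - x - (u - y) = y - x := sub_sub_sub_cancel_left _ _ _
  rw [← key]
  simp only [mem_setOf_eq, mem_box] at hux huy
  rw [mem_box]
  intro k
  have h1 := hux k
  have h2 := huy k
  simp only [Pi.sub_apply] at h1 h2 ⊢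
  push_cast
  omega

/-! ### Three independent events -/

/-- **Events read on three pairwise disjoint sets of pairs are independent under `P_{1/2}`**:
`P(A ∩ B ∩ C) = P(A) P(B) P(C)`. [folklore] -/
theorem real_inter_inter_eq_of_disjoint {S T U : Set (Sym2 (Site 2))} (hST : Disjoint S T)
    (hSU : Disjoint S U) (hTU : Disjoint T U) {A B C : Set (BondConfig (Site 2))}
    (hA : DeterminedBy A S) (hB : DeterminedBy B T) (hC : DeterminedBy C U)
    (hAm : MeasurableSet A) (hBm : MeasurableSet B) (hCm : MeasurableSet C) :
    (bondPercolation (zdGraph 2) half).real (A ∩ B ∩ C) =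
      (bondPercolation (zdGraph 2) half).real A * (bondPercolation (zdGraph 2) half).real B *
        (bondPercolation (zdGraph 2) half).real C := by
  have hAB : DeterminedBy (A ∩ B) (S ∪ T) :=
    (hA.mono subset_union_left).inter (hB.mono subset_union_right)
  have hdisj : Disjoint (S ∪ T) U := Set.disjoint_union_left.2 ⟨hSU, hTU⟩
  rw [bondPercolation_real_inter_of_disjoint (zdGraph 2) half hdisj hAB hC (hAm.inter hBm) hCm,
    bondPercolation_real_inter_of_disjoint (zdGraph 2) half hST hA hB hAm hBm]

/-! ### Pair probabilities -/

/-- **Always: `P(A_e ∩ A_{e'}) ≤ a(M)`.** [folklore] -/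
theorem real_inter_edgeFourArm_le_self (x y : Site 2) (i j : Fin 2) (M : ℕ) :
    (bondPercolation (zdGraph 2) half).real
        (edgeFourArm {u : Site 2 | u - x ∈ box 2 M} x i ∩
          edgeFourArm {u : Site 2 | u - y ∈ box 2 M} y j) ≤
      (bondPercolation (zdGraph 2) half).real (edgeFourArm (↑(box 2 M) : Set (Site 2)) 0 0) := by
  rw [← real_edgeFourArm_shiftBox_eq x M i]
  exact measureReal_mono inter_subset_left

/-- **Far pairs: `P(A_e ∩ A_{e'}) ≤ a(h)²` when `‖y - x‖_∞ > 2h`, `1 ≤ h ≤ M`** — both edges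
have four arms to the boundaries of the disjoint boxes `x + [-h,h]²`, `y + [-h,h]²`, two
independent events each of probability `a(h)`. [folklore] -/
theorem real_inter_edgeFourArm_le_sq {x y : Site 2} (i j : Fin 2) {h M : ℕ} (hh : 1 ≤ h)
    (hhM : h ≤ M) (hxy : y - x ∉ box 2 (2 * h)) :
    (bondPercolation (zdGraph 2) half).real
        (edgeFourArm {u : Site 2 | u - x ∈ box 2 M} x i ∩
          edgeFourArm {u : Site 2 | u - y ∈ box 2 M} y j) ≤
      (bondPercolation (zdGraph 2) half).real (edgeFourArm (↑(box 2 h) : Set (Site 2)) 0 0) ^ 2 := by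
  set P := bondPercolation (zdGraph 2) half with hP
  set Ax := edgeFourArm {u : Site 2 | u - x ∈ box 2 h} x i with hAx
  set Ay := edgeFourArm {u : Site 2 | u - y ∈ box 2 h} y j with hAy
  have hsub : (edgeFourArm {u : Site 2 | u - x ∈ box 2 M} x i ∩
      edgeFourArm {u : Site 2 | u - y ∈ box 2 M} y j : Set (BondConfig (Site 2))) ≤ᵐ[P]
      (Ax ∩ Ay : Set (BondConfig (Site 2))) := by
    filter_upwards [ae_subset_edgeSet (zdGraph 2) half] with ω hω h
    exact ⟨edgeFourArm_shiftBox_mono hh hhM x i hω h.1, edgeFourArm_shiftBox_mono hh hhM y j hω h.2⟩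
  have hdisj : Disjoint {u : Site 2 | u - x ∈ box 2 h}.sym2 {u : Site 2 | u - y ∈ box 2 h}.sym2 := by
    refine disjoint_sym2_of_forall fun e he a ha hax => ?_
    induction e using Sym2.ind with
    | h b c =>
      rw [Set.mk_mem_sym2_iff] at he
      rcases Sym2.mem_iff.1 ha with rfl | rfl
      · exact Set.disjoint_left.1 (shiftBox_disjoint hxy) hax he.1
      · exact Set.disjoint_left.1 (shiftBox_disjoint hxy) hax he.2
  have hind : P.real (Ax ∩ Ay) = P.real Ax * P.real Ay :=
    bondPercolation_real_inter_of_disjoint (zdGraph 2) half hdisj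
      (determinedBy_edgeFourArm subset_rfl x i) (determinedBy_edgeFourArm subset_rfl y j)
      (measurableSet_edgeFourArm (finite_shiftBox x h) x i)
      (measurableSet_edgeFourArm (finite_shiftBox y h) y j)
  calc P.real (edgeFourArm {u : Site 2 | u - x ∈ box 2 M} x i ∩
        edgeFourArm {u : Site 2 | u - y ∈ box 2 M} y j)
      ≤ P.real (Ax ∩ Ay) := ENNReal.toReal_mono (measure_ne_top _ _) (measure_mono_ae hsub)
    _ = P.real Ax * P.real Ay := hind
    _ = P.real (edgeFourArm (↑(box 2 h) : Set (Site 2)) 0 0) ^ 2 := by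
        rw [hAx, hAy, real_edgeFourArm_shiftBox_eq x h i, real_edgeFourArm_shiftBox_eq y h j, sq]

/-- **Intermediate pairs: `P(A_e ∩ A_{e'}) ≤ a(h)² · α₄(L, M)` when `‖y - x‖_∞ > 2h`,
`‖y - x‖_∞ + h ≤ L - 1`, `1 ≤ h`, `L ≤ M`** — besides the two small-box events, the arms of `e`
cross the annulus `x + A_{L,M}`, which avoids both small boxes; three independent events
(GPS 2013, §4.3: "`P[x, y both A-important] ≲ α₄(ℓ/2)² α₄(2ℓ, d)`"-type bound, bond-`ℤ²`, cluster
form). [folklore] -/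
theorem real_inter_edgeFourArm_le_sq_mul {x y : Site 2} (i j : Fin 2) {h L M : ℕ} (hh : 1 ≤ h)
    (hxy : y - x ∉ box 2 (2 * h)) (hhL : h ≤ L - 1) (hyx : y - x ∈ box 2 (L - 1 - h))
    (hLM : L ≤ M) :
    (bondPercolation (zdGraph 2) half).real
        (edgeFourArm {u : Site 2 | u - x ∈ box 2 M} x i ∩
          edgeFourArm {u : Site 2 | u - y ∈ box 2 M} y j) ≤
      (bondPercolation (zdGraph 2) half).real (edgeFourArm (↑(box 2 h) : Set (Site 2)) 0 0) ^ 2 *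
        (bondPercolation (zdGraph 2) half).real (fourArmTwoClusters L M) := by
  set P := bondPercolation (zdGraph 2) half with hP
  have hL : 1 ≤ L := by omega
  have hhM : h ≤ M := by omega
  set Ax := edgeFourArm {u : Site 2 | u - x ∈ box 2 h} x i with hAx
  set Ay := edgeFourArm {u : Site 2 | u - y ∈ box 2 h} y j with hAy
  set T : Set (BondConfig (Site 2)) :=
    BondConfig.relabel (sym2Equiv (Site.shift (-x))) ⁻¹' fourArmTwoClusters L M with hT
  set U : Set (Sym2 (Site 2)) :=
    (sym2Equiv (Site.shift (-x))) ⁻¹' ↑((annulus 2 (L - 1) M).sym2) with hU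
  -- inclusion on lattice configurations
  have hsub : (edgeFourArm {u : Site 2 | u - x ∈ box 2 M} x i ∩
      edgeFourArm {u : Site 2 | u - y ∈ box 2 M} y j : Set (BondConfig (Site 2))) ≤ᵐ[P]
      (Ax ∩ Ay ∩ T : Set (BondConfig (Site 2))) := by
    filter_upwards [ae_subset_edgeSet (zdGraph 2) half] with ω hω h
    exact ⟨⟨edgeFourArm_shiftBox_mono hh hhM x i hω h.1, edgeFourArm_shiftBox_mono hh hhM y j hω h.2⟩,
      relabel_mem_fourArmTwoClusters_of_edgeFourArm hL hLM (fun u hu => hu) hω h.1⟩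
  -- the three regions are pairwise disjoint
  have hU_mem : ∀ e ∈ U, ∀ a ∈ e, a - x ∉ box 2 (L - 1) := by
    intro e he a ha
    have := (mem_preimage_sym2Equiv_sym2 (Site.shift (-x)) _ e).1 he a ha
    rw [Site.shift_apply, ← sub_eq_add_neg, mem_annulus] at this
    exact this.2
  have hdisj₁ : Disjoint {u : Site 2 | u - x ∈ box 2 h}.sym2 {u : Site 2 | u - y ∈ box 2 h}.sym2 := by
    refine disjoint_sym2_of_forall fun e he a ha hax => ?_
    induction e using Sym2.ind with
    | h b c =>
      rw [Set.mk_mem_sym2_iff] at he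
      rcases Sym2.mem_iff.1 ha with rfl | rfl
      · exact Set.disjoint_left.1 (shiftBox_disjoint hxy) hax he.1
      · exact Set.disjoint_left.1 (shiftBox_disjoint hxy) hax he.2
  have hdisj₂ : Disjoint {u : Site 2 | u - x ∈ box 2 h}.sym2 U := by
    refine disjoint_sym2_of_forall fun e he a ha (hax : a - x ∈ box 2 h) => ?_
    exact hU_mem e he a ha (box_mono 2 hhL hax)
  have hdisj₃ : Disjoint {u : Site 2 | u - y ∈ box 2 h}.sym2 U := by
    refine disjoint_sym2_of_forall fun e he a ha (hay : a - y ∈ box 2 h) => ?_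
    apply hU_mem e he a ha
    have := add_mem_box hay hyx
    rw [sub_add_sub_cancel] at this
    exact box_mono 2 (by omega) this
  -- independence
  have hTdet : DeterminedBy T U := by
    have hA := determinedBy_fourArmTwoClusters L M
    rw [determinedBy_iff] at hA ⊢
    intro ω ω' hωω'
    simp only [hT, mem_preimage, BondConfig.relabel_apply]
    apply hA
    rw [← Set.image_inter_preimage, ← Set.image_inter_preimage]
    exact congrArg _ hωω'
  have hTm : MeasurableSet T :=
    (determinedBy_fourArmTwoClusters L M).measurableSet_of_finset.preimage
      (BondConfig.relabel (sym2Equiv (Site.shift (-x)))).measurable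
  have hind : P.real (Ax ∩ Ay ∩ T) = P.real Ax * P.real Ay * P.real T :=
    real_inter_inter_eq_of_disjoint hdisj₁ hdisj₂ hdisj₃
      (determinedBy_edgeFourArm subset_rfl x i) (determinedBy_edgeFourArm subset_rfl y j) hTdet
      (measurableSet_edgeFourArm (finite_shiftBox x h) x i)
      (measurableSet_edgeFourArm (finite_shiftBox y h) y j) hTm
  have hTP : P.real T = P.real (fourArmTwoClusters L M) := by
    rw [hT, hP]
    exact bondPercolation_real_preimage_shift _ _ _
  calc P.real (edgeFourArm {u : Site 2 | u - x ∈ box 2 M} x i ∩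
        edgeFourArm {u : Site 2 | u - y ∈ box 2 M} y j)
      ≤ P.real (Ax ∩ Ay ∩ T) := ENNReal.toReal_mono (measure_ne_top _ _) (measure_mono_ae hsub)
    _ = P.real Ax * P.real Ay * P.real T := hind
    _ = P.real (edgeFourArm (↑(box 2 h) : Set (Site 2)) 0 0) ^ 2 *
          P.real (fourArmTwoClusters L M) := by
        rw [hAx, hAy, hTP, real_edgeFourArm_shiftBox_eq x h i, real_edgeFourArm_shiftBox_eq y h j,
          sq]

/-- **The pair bound of the second-moment computation, packaged** (bond-`ℤ²`, cluster form; GPS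
2013 §4.3–4.4 / Kesten 1987): for edges `e = s(x, x+eᵢ)`, `e' = s(y, y+e_j)`, radii `1 ≤ h`,
`L ≤ M` with `‖y - x‖_∞ > 2h` and `‖y - x‖_∞ + h ≤ L - 1`, the probability that both have four
alternating arms to the boundaries of the boxes of radius `M` around them is at most
`a(h)² · α₄(L, M)`, `a(h) = P(edgeFourArm [-h,h]² 0 0)`, `α₄(L,M) = P(fourArmTwoClusters L M)`.
[folklore] -/
theorem real_inter_edgeFourArm_shiftBox_le :
    ∀ (x y : Site 2) (i j : Fin 2) (h L M : ℕ), 1 ≤ h → y - x ∉ box 2 (2 * h) → h ≤ L - 1 →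
      y - x ∈ box 2 (L - 1 - h) → L ≤ M →
        (bondPercolation (zdGraph 2) half).real
            (edgeFourArm {u : Site 2 | u - x ∈ box 2 M} x i ∩
              edgeFourArm {u : Site 2 | u - y ∈ box 2 M} y j) ≤
          (bondPercolation (zdGraph 2) half).real (edgeFourArm (↑(box 2 h) : Set (Site 2)) 0 0) ^ 2 *
            (bondPercolation (zdGraph 2) half).real (fourArmTwoClusters L M) :=
  fun _ _ i j _ _ _ hh hxy hhL hyx hLM => real_inter_edgeFourArm_le_sq_mul i j hh hxy hhL hyx hLM

end Summit.CriticalPhenomena.CardyFormulaZ2.Theorems.CardyMeckeFlip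

end
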